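import Summits.QuantumFields.YangMills.Theorems.BalabanUVNodesN15KingModelFullPropagatorL2Local
import Summits.QuantumFields.YangMills.Theorems.BalabanUVNodesN15KingModelFullPropagatorL2Bounds

/-!
# BalabanUVNodes ∕ N15 — THE KING-MODEL RUNG, CURVED EDITION (PART Ξ-b): [B9] (3.46) AT `U ≡ 1`, PRINTED (LOCALISED) SHAPE — THE FOURTH ENTRY
# `‖h·∇A₀⁻¹∇*λ‖ ≤ C·|h|_∞·e^{−δ|b − b′|}·‖λ‖` AND THE FOUR-ENTRY `L²` PACKAGE, for King's full `A = 0` propagator, UNIFORMLY in `K`, the volume and the mass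
# (Track A, DAG node N15 = NE2; FAN-OUT v1.1 §N15 s3 «KING-MODEL RUNG … + the one-line statement of what the curved case adds»)

HONEST FRAMING.  Count-neutral operator bookkeeping (cell `pub-ymgap`, seat `pub-ymgap-dag-n15-e` g10; `--supports stmt-QuantumFields-20544 --as helper` = K3⁷
`SpineGivenEndpointR13SepCoPH`, WORDS-143).  TEMPLATE LITERATURE, `A = 0`: C. King's scalar U(1)-Higgs MODEL on finite tori ([King1986] (2.13) p. 653,
Prop. 3.7 (3.63) p. 663), NOT Bałaban's covariant objects.  [Balaban1985BackgroundPropagators] Thm 3.1 (3.46) p. 398, fourth entry: «`‖h∇_UG′∇*_Uλ‖ ≤ B₀·1·|h|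
e^{−δ₀d(y,y′)}‖λ‖`, `supp h ⊂ Δ(y)`, `supp λ ⊂ Δ(y′)`».  At `U ≡ 1`, for King's full `A = 0` propagator, the mixed object's kernel is the Calderón–Zygmund
kernel `N^{−(d+1)}DD(z, x) ≍ |x − z|^{−(d+1)}` of parts V ∕ Ψ: it is NOT `ℓ¹` near the diagonal, so Schur's test only serves FAR blocks (`|b − b′| ≥ 2`, where
the fine distance is `≥ N` and `N^{−(d+1)}|DD| ≤ N^{−(d+1)}C e^{−δ|b−b′|}`, part Ψ-a `fullPropDD_powerLaw_decay_unif`, with `N^{d+1}` points per block); NEAR blocks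
are covered by part X's GLOBAL bound `‖∇A₀⁻¹∇*‖ ≤ 1` (`fullPropOps_l2_unif`, clause 4).  Decided in the MODEL; NOT the printed proposition (covariant `G(U)`,
`Reg335`, multiscale sites); NE2⁺ is NOT PRINTED and not proved; NOT a node discharge; nothing continuum ∕ ℝ⁴ ∕ OS ∕ mass-gap ∕ Clay.  0 `sorry`, 0 `def`,
standard axioms.
* §1 `card_block_sum_eq` (`Σ_z N^{−(d+1)}1_{b′}(z) = 1`), ★ `l2_local_of_far_kernel_bound` (Schur on a pair of blocks with a CONSTANT kernel bound);
* §2 ★★ **`fullPropMixedOp_l2_local`** — `∃ C δ > 0 ∀ K ≥ 1 ∀ N = L^K ∀ cube 2L^e ∀ 0 < m² ≤ m₀² ∀ μ μ′ ∀ λ h H_h b b′` (cut-off in `b`, source in `b′`):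
  `Σ_x(h(x)·N((A₀⁻¹∇*_μλ)(x + e_μ′) − (A₀⁻¹∇*_μλ)(x)))² ≤ (C·H_h·e^{−δ|b−b′|})²·Σ_zλ(z)²`;
* §3 ★★ **`kingFullProp_B9Thm31_l2_local_at_trivialU`** — the four localised entries `hGλ`, `h∇Gλ`, `hG∇*λ`, `h∇G∇*λ` of (3.46) at `U ≡ 1` under ONE `(C, δ)`.
WHAT THE CURVED CASE ADDS (one line): (3.46) itself for `G′(U)` over `Reg335`, all six entries with the multiscale prefactors — printed (random-walk expansion).
HONEST SCOPE.  (i) `A = 0`, periodic b.c., odd `L ≥ 3`, cubes `2L^e`, `K ≥ 1`, `0 < m² ≤ m₀²`; (ii) King's spelling, plain `ℓ²` sums, forward η-differences;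
(iii) single-block cut-off ∕ source; (iv) entries 5–6 (`h∇∇Gλ`, `hG∇*∇*λ`) NOT treated; (v) not Bałaban's `G(U)`; not a discharge.
Locators: [Balaban1985BackgroundPropagators] Thm 3.1 (3.46) p. 398; [King1986] (2.13) p. 653, Prop. 3.7 (3.63) p. 663, (4.1)–(4.5) p. 670; [Dimock2013] App. D Lemma 29.
-/

noncomputable section

namespace Summit.QuantumFields.YangMills.BalabanUVNodes.N15KingModelRung.Curved

open Real Finset Matrix
open Literature.MathematicalPhysics.QuantumFieldTheory.Balaban1983to89.B5Prop11Plancherel (Tor fine unitVec)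
open Literature.MathematicalPhysics.QuantumFieldTheory.King1986 (aK aK_pos)
open Literature.MathematicalPhysics.QuantumFieldTheory.King1986.Torus (fineOp constrainedProp blockOf tdistT tdistT_nonneg tdistT_symm
  tdistT_self)

variable {d : ℕ} (L : ℕ) [NeZero L]

/-! ## §1 Schur's test on a pair of far blocks -/

omit [NeZero L] in
/-- A unit block has `N^{d+1}` fine points: `Σ_z N^{−(d+1)}·1_{b}(z) = 1`. [folklore] -/
theorem card_block_sum_eq (N : ℕ) [NeZero N] (M : Fin (d + 1) → ℕ) [∀ μ, NeZero (M μ)] (b : Tor M) :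
    ∑ z : Tor (fine N M), (if blockOf N M z = b then ((N : ℝ) ^ (d + 1))⁻¹ else (0 : ℝ)) = 1 := by
  classical
  have hN : ((N : ℝ) ^ (d + 1)) ≠ 0 := pow_ne_zero _ (by exact_mod_cast NeZero.ne N)
  rw [sum_fine_blockOf N M (fun bb => if bb = b then ((N : ℝ) ^ (d + 1))⁻¹ else (0 : ℝ)), Finset.sum_ite_eq' Finset.univ b]
  simp only [Finset.mem_univ, if_true]
  exact mul_inv_cancel₀ hN

omit [NeZero L] in
/-- ★ **THE LOCALISED SCHUR STEP, FAR BLOCKS**: if `|k(x, z)| ≤ C₀·e^{−δ₀|b − b′|}` for ALL `x ∈ b`, `z ∈ b′` (a CONSTANT kernel bound on the pair of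
blocks), then for every cut-off `h` (`|h| ≤ H_h`, `supp h ⊂ b`) and source `λ` (`supp λ ⊂ b′`):
`Σ_x (h(x)·Σ_z N^{−(d+1)}k(x, z)λ(z))² ≤ (C₀·H_h·e^{−δ₀|b−b′|})²·Σ_zλ(z)²` — Ξ-a's Schur test for `h(x)N^{−(d+1)}k(x, z)1_{b′}(z)`, each block weighing
`N^{d+1}·N^{−(d+1)} = 1`. [cite: Balaban1985BackgroundPropagators, Thm 3.1 (3.46) p.398 (shape)] -/
theorem l2_local_of_far_kernel_bound (N : ℕ) [NeZero N] (M : Fin (d + 1) → ℕ) [∀ μ, NeZero (M μ)]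
    (k : Tor (fine N M) → Tor (fine N M) → ℝ) {C₀ δ₀ : ℝ} (hC₀ : 0 ≤ C₀) (b b' : Tor M)
    (hk : ∀ x z, blockOf N M x = b → blockOf N M z = b' → |k x z| ≤ C₀ * Real.exp (-(δ₀ * tdistT M b b')))
    (lam h : Tor (fine N M) → ℝ) {Hh : ℝ} (hHh : 0 ≤ Hh) (hh : ∀ x, |h x| ≤ Hh)
    (hsh : ∀ x, h x ≠ 0 → blockOf N M x = b) (hsl : ∀ z, lam z ≠ 0 → blockOf N M z = b') :
    ∑ x, (h x * ∑ z, ((N : ℝ) ^ (d + 1))⁻¹ * k x z * lam z) ^ 2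
      ≤ (C₀ * Hh * Real.exp (-(δ₀ * tdistT M b b'))) ^ 2 * ∑ z, lam z ^ 2 := by
  classical
  set c : ℝ := ((N : ℝ) ^ (d + 1))⁻¹ with hcdef
  have hc0 : 0 ≤ c := by positivity
  set E : ℝ := Real.exp (-(δ₀ * tdistT M b b')) with hEdef
  have hE0' : 0 ≤ E := (Real.exp_pos _).le
  set Kk : Tor (fine N M) → Tor (fine N M) → ℝ := fun x z => h x * (c * k x z) * (if blockOf N M z = b' then 1 else 0) with hKk
  have hrepr : ∀ x, h x * ∑ z, c * k x z * lam z = ∑ z, Kk x z * lam z := by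
    intro x
    rw [Finset.mul_sum]
    refine Finset.sum_congr rfl fun z _ => ?_
    by_cases hz : lam z = 0
    · rw [hz, mul_zero, mul_zero, mul_zero]
    · rw [hKk]; simp only [hsl z hz, if_true]; ring
  rw [Finset.sum_congr rfl fun x _ => by rw [hrepr x]]
  set R : ℝ := C₀ * Hh * E with hRdef
  have hR0 : 0 ≤ R := by positivity
  -- termwise bounds: `|Kk x z| ≤ H_h·C₀·E·(c·1_{b′}(z))` (rows) and `≤ H_h·C₀·E·(c·1_b(x))` (columns)
  have hKabs : ∀ x z, |Kk x z| ≤ Hh * C₀ * E * c * ((if blockOf N M x = b then (1 : ℝ) else 0) * (if blockOf N M z = b' then 1 else 0)) := by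
    intro x z
    by_cases hx : h x = 0
    · rw [hKk]; simp only [hx, zero_mul, abs_zero]
      refine mul_nonneg (by positivity) (mul_nonneg ?_ ?_) <;> split_ifs <;> norm_num
    have hxb := hsh x hx
    by_cases hzb : blockOf N M z = b'
    · have hkxz := hk x z hxb hzb
      rw [hKk]; simp only [hzb, hxb, if_true, mul_one]
      rw [abs_mul, abs_mul, abs_of_nonneg hc0]
      calc |h x| * (c * |k x z|) ≤ Hh * (c * (C₀ * E)) :=
            mul_le_mul (hh x) (mul_le_mul_of_nonneg_left hkxz hc0) (by positivity) hHh
        _ = Hh * C₀ * E * c := by ring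
    · rw [hKk]; simp only [hzb, if_false, mul_zero, abs_zero]; exact le_rfl
  have hone_b' : ∑ z : Tor (fine N M), c * (if blockOf N M z = b' then (1 : ℝ) else 0) = 1 := by
    rw [hcdef]
    refine Eq.trans (Finset.sum_congr rfl fun z _ => ?_) (card_block_sum_eq N M b')
    split_ifs <;> simp
  have hone_b : ∑ x : Tor (fine N M), c * (if blockOf N M x = b then (1 : ℝ) else 0) = 1 := by
    rw [hcdef]
    refine Eq.trans (Finset.sum_congr rfl fun x _ => ?_) (card_block_sum_eq N M b)
    split_ifs <;> simp
  have hrow : ∀ x, ∑ z, |Kk x z| ≤ R := fun x => by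
    have hxle : (if blockOf N M x = b then (1 : ℝ) else 0) ≤ 1 := by split_ifs <;> norm_num
    calc ∑ z, |Kk x z| ≤ ∑ z, Hh * C₀ * E * c * ((if blockOf N M x = b then (1 : ℝ) else 0) * (if blockOf N M z = b' then 1 else 0)) :=
          Finset.sum_le_sum fun z _ => hKabs x z
      _ ≤ ∑ z, Hh * C₀ * E * (c * (if blockOf N M z = b' then (1 : ℝ) else 0)) :=
          Finset.sum_le_sum fun z _ => by
            have h0 : 0 ≤ (if blockOf N M z = b' then (1 : ℝ) else 0) := by split_ifs <;> norm_num
            nlinarith [mul_nonneg (mul_nonneg (mul_nonneg (mul_nonneg hHh hC₀) hE0') hc0) h0]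
      _ = R := by rw [← Finset.mul_sum, hone_b', mul_one, hRdef]; ring
  have hcol : ∀ z, ∑ x, |Kk x z| ≤ R := fun z => by
    have hzle : (if blockOf N M z = b' then (1 : ℝ) else 0) ≤ 1 := by split_ifs <;> norm_num
    calc ∑ x, |Kk x z| ≤ ∑ x, Hh * C₀ * E * c * ((if blockOf N M x = b then (1 : ℝ) else 0) * (if blockOf N M z = b' then 1 else 0)) :=
          Finset.sum_le_sum fun x _ => hKabs x z
      _ ≤ ∑ x, Hh * C₀ * E * (c * (if blockOf N M x = b then (1 : ℝ) else 0)) :=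
          Finset.sum_le_sum fun x _ => by
            have h0 : 0 ≤ (if blockOf N M x = b then (1 : ℝ) else 0) := by split_ifs <;> norm_num
            nlinarith [mul_nonneg (mul_nonneg (mul_nonneg (mul_nonneg hHh hC₀) hE0') hc0) h0]
      _ = R := by rw [← Finset.mul_sum, hone_b, mul_one, hRdef]; ring
  have hS := schur_finsum_sq_le Kk lam hR0 hrow hcol
  calc _ ≤ R * R * ∑ z, lam z ^ 2 := hS
    _ = (C₀ * Hh * E) ^ 2 * ∑ z, lam z ^ 2 := by rw [hRdef, sq]

/-! ## §2 The fourth entry `h∇G∇*λ` -/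

set_option maxHeartbeats 400000 in
/-- ★★ **[B9] (3.46), ENTRY `h∇G∇*λ`, AT `U ≡ 1`**: for odd `L ≥ 3`, `a > 0`, `m₀² ≥ 0` there are `C, δ > 0` such that for EVERY `K ≥ 1` (`N = L^K`), cube
`2L^e`, mass `0 < m² ≤ m₀²`, directions `μ, μ′`, every cut-off `h` (`|h| ≤ H_h`, `supp h ⊂ b`) and source `λ` (`supp λ ⊂ b′`):
`Σ_x(h(x)·N((A₀⁻¹∇*_μλ)(x + e_μ′) − (A₀⁻¹∇*_μλ)(x)))² ≤ (C·H_h·e^{−δ|b−b′|})²·Σ_zλ(z)²` — FAR blocks (`|b − b′| ≥ 2`): V-b's kernel sum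
`Σ_z N^{−(d+1)}DD(z, x)λ(z)`, fine distance `≥ N` between the two blocks, `N^{−(d+1)}|DD| ≤ N^{−(d+1)}·C·e^{−δ|b−b′|}` (part Ψ-a `fullPropDD_powerLaw_decay_unif`),
§1's Schur step; NEAR blocks: part X's global `‖∇A₀⁻¹∇*λ‖ ≤ ‖λ‖` and `e^{−δ|b−b′|} ≥ e^{−δ}`.  The printed «`‖h∇_UG′∇*_Uλ‖ ≤ B₀|h|e^{−δ₀d(y,y′)}‖λ‖`» at `U ≡ 1`.
[cite: Balaban1985BackgroundPropagators, Thm 3.1 (3.46) p.398 (fourth entry); King1986, (2.13) p.653, Prop. 3.7 (3.63) p.663, (4.1)–(4.5) p.670] -/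
theorem fullPropMixedOp_l2_local (hLodd : Odd L) (hL : 2 ≤ L) {a : ℝ} (ha : 0 < a) {m0sq : ℝ} (hm0 : 0 ≤ m0sq) :
    ∃ C δ : ℝ, 0 < C ∧ 0 < δ ∧ ∀ (K : ℕ), 1 ≤ K → ∀ (N : ℕ) [NeZero N], N = L ^ K →
      ∀ (e : ℕ) (M : Fin (d + 1) → ℕ) [∀ μ, NeZero (M μ)], (∀ μ, M μ = 2 * L ^ e) →
      ∀ (msq : ℝ), 0 < msq → msq ≤ m0sq → ∀ (μ μ' : Fin (d + 1)) (lam h : Tor (fine N M) → ℝ) (Hh : ℝ) (b b' : Tor M), 0 ≤ Hh →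
        (∀ x, |h x| ≤ Hh) → (∀ x, h x ≠ 0 → blockOf N M x = b) → (∀ z, lam z ≠ 0 → blockOf N M z = b') →
        ∑ x, (h x * ((N : ℝ) * (((fineOp N M (aK a L K) (((N : ℕ) : ℝ) ^ 2) msq)⁻¹
                *ᵥ (fun y => (N : ℝ) * (lam (y - unitVec (fine N M) μ) - lam y))) (x + unitVec (fine N M) μ')
            - ((fineOp N M (aK a L K) (((N : ℕ) : ℝ) ^ 2) msq)⁻¹
                *ᵥ (fun y => (N : ℝ) * (lam (y - unitVec (fine N M) μ) - lam y))) x))) ^ 2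
          ≤ (C * Hh * Real.exp (-(δ * tdistT M b b'))) ^ 2 * ∑ z, lam z ^ 2 := by
  obtain ⟨C₀, δ₀, hC₀, hδ₀, HDD⟩ := fullPropDD_powerLaw_decay_unif (d := d) L hLodd hL ha hm0
  obtain ⟨γ₀, hγ₀, HX⟩ := fullPropOps_l2_unif (d := d) L hL ha
  refine ⟨(C₀ + 1) * Real.exp (2 * δ₀), δ₀, by positivity, hδ₀, ?_⟩
  intro K hK N _ hN e M _ hM msq hmsq hcap μ μ' lam h Hh b b' hHh hh hsh hsl
  have hN1 : (1 : ℝ) ≤ (N : ℝ) := by rw [hN]; exact_mod_cast Nat.one_le_pow K L (by omega)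
  have hN0 : 0 < (N : ℝ) := by linarith
  have hNK : ((L : ℝ) ^ K) = (N : ℝ) := by rw [hN, Nat.cast_pow]
  set D : ℝ := tdistT M b b' with hDdef
  have hD0 : 0 ≤ D := tdistT_nonneg M b b'
  set E : ℝ := Real.exp (-(δ₀ * D)) with hEdef
  have hE0 : 0 < E := Real.exp_pos _
  have hlam2 : 0 ≤ ∑ z, lam z ^ 2 := Finset.sum_nonneg fun z _ => sq_nonneg _
  rcases le_or_gt 2 D with hfar | hnear
  · -- FAR blocks: the kernel sum and Schur on the block pair
    rw [Finset.sum_congr rfl fun x _ => by rw [inv_deriv_adjDeriv_eq_sum N M _ _ _ lam x μ μ']]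
    have hk : ∀ x z, blockOf N M x = b → blockOf N M z = b' →
        |(N : ℝ) * ((N : ℝ) * (constrainedProp N M (aK a L K) (((N : ℕ) : ℝ) ^ 2) msq (z + unitVec (fine N M) μ) (x + unitVec (fine N M) μ')
              - constrainedProp N M (aK a L K) (((N : ℕ) : ℝ) ^ 2) msq z (x + unitVec (fine N M) μ'))
            - (N : ℝ) * (constrainedProp N M (aK a L K) (((N : ℕ) : ℝ) ^ 2) msq (z + unitVec (fine N M) μ) x
              - constrainedProp N M (aK a L K) (((N : ℕ) : ℝ) ^ 2) msq z x))|
          ≤ C₀ * Real.exp (-(δ₀ * tdistT M b b')) := by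
      intro x z hxb hzb
      -- the two blocks are `≥ 2` apart, so the fine distance is `≥ N + 1`
      have hr : (N : ℝ) + 1 ≤ tdistT (fine N M) z x := by
        have h1 := mul_tdistT_blockOf_le N M z x
        rw [hzb, hxb, tdistT_symm M b' b, ← hDdef] at h1
        nlinarith
      have hne : z ≠ x := by
        intro h; rw [h, tdistT_self] at hr; linarith
      have h := HDD K hK N hN e M hM msq hmsq hcap μ μ' z x hne
      rw [hzb, hxb, tdistT_symm M b' b, ← hDdef, hNK] at h
      refine h.trans ?_
      have hq : ((N : ℝ) / tdistT (fine N M) z x) ^ (d + 1) ≤ 1 := by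
        apply pow_le_one₀ (by have := tdistT_nonneg (fine N M) z x; positivity)
        rw [div_le_one (by linarith)]; linarith
      calc C₀ * ((N : ℝ) / tdistT (fine N M) z x) ^ (d + 1) * Real.exp (-(δ₀ * D))
          ≤ C₀ * 1 * Real.exp (-(δ₀ * D)) := by
            exact mul_le_mul_of_nonneg_right (mul_le_mul_of_nonneg_left hq hC₀.le) hE0.le
        _ = C₀ * Real.exp (-(δ₀ * D)) := by rw [mul_one]
    have h := l2_local_of_far_kernel_bound N M (fun x z =>
        (N : ℝ) * ((N : ℝ) * (constrainedProp N M (aK a L K) (((N : ℕ) : ℝ) ^ 2) msq (z + unitVec (fine N M) μ) (x + unitVec (fine N M) μ')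
              - constrainedProp N M (aK a L K) (((N : ℕ) : ℝ) ^ 2) msq z (x + unitVec (fine N M) μ'))
            - (N : ℝ) * (constrainedProp N M (aK a L K) (((N : ℕ) : ℝ) ^ 2) msq (z + unitVec (fine N M) μ) x
              - constrainedProp N M (aK a L K) (((N : ℕ) : ℝ) ^ 2) msq z x)))
      hC₀.le b b' hk lam h hHh hh hsh hsl
    refine h.trans (mul_le_mul_of_nonneg_right (pow_le_pow_left₀ (by positivity) ?_ 2) hlam2)
    refine mul_le_mul_of_nonneg_right (mul_le_mul_of_nonneg_right ?_ hHh) hE0.le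
    have h1 : (1 : ℝ) ≤ Real.exp (2 * δ₀) := Real.one_le_exp (by linarith)
    nlinarith
  · -- NEAR blocks (`|b − b′| < 2`): part X's global bound `Σ_x F² ≤ ‖λ‖²`, `|h| ≤ H_h`, and `(C₀ + 1)e^{2δ₀}e^{−δ₀D} ≥ 1`
    obtain ⟨-, -, -, h4⟩ := HX K hK N hN M msq hmsq μ' μ lam lam
    have hFsum : ∑ x, ((N : ℝ) * (((fineOp N M (aK a L K) (((N : ℕ) : ℝ) ^ 2) msq)⁻¹
                *ᵥ (fun y => (N : ℝ) * (lam (y - unitVec (fine N M) μ) - lam y))) (x + unitVec (fine N M) μ')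
            - ((fineOp N M (aK a L K) (((N : ℕ) : ℝ) ^ 2) msq)⁻¹
                *ᵥ (fun y => (N : ℝ) * (lam (y - unitVec (fine N M) μ) - lam y))) x)) ^ 2
        ≤ ∑ z, lam z ^ 2 := by
      have e1 : ∀ x, ((N : ℝ) * (((fineOp N M (aK a L K) (((N : ℕ) : ℝ) ^ 2) msq)⁻¹
                *ᵥ (fun y => (N : ℝ) * (lam (y - unitVec (fine N M) μ) - lam y))) (x + unitVec (fine N M) μ')
            - ((fineOp N M (aK a L K) (((N : ℕ) : ℝ) ^ 2) msq)⁻¹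
                *ᵥ (fun y => (N : ℝ) * (lam (y - unitVec (fine N M) μ) - lam y))) x)) ^ 2
          = (N : ℝ) ^ 2 * ((((fineOp N M (aK a L K) (((N : ℕ) : ℝ) ^ 2) msq)⁻¹
                *ᵥ (fun y => (N : ℝ) * (lam (y - unitVec (fine N M) μ) - lam y))) (x + unitVec (fine N M) μ')
            - ((fineOp N M (aK a L K) (((N : ℕ) : ℝ) ^ 2) msq)⁻¹
                *ᵥ (fun y => (N : ℝ) * (lam (y - unitVec (fine N M) μ) - lam y))) x)) ^ 2 := fun x => by ring
      rw [Finset.sum_congr rfl fun x _ => e1 x, ← Finset.mul_sum]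
      have e2 : lam ⬝ᵥ lam = ∑ z, lam z ^ 2 := by
        rw [dotProduct]; exact Finset.sum_congr rfl fun z _ => by ring
      rw [← e2]
      exact h4
    have hstep : ∀ x, (h x * ((N : ℝ) * (((fineOp N M (aK a L K) (((N : ℕ) : ℝ) ^ 2) msq)⁻¹
                *ᵥ (fun y => (N : ℝ) * (lam (y - unitVec (fine N M) μ) - lam y))) (x + unitVec (fine N M) μ')
            - ((fineOp N M (aK a L K) (((N : ℕ) : ℝ) ^ 2) msq)⁻¹
                *ᵥ (fun y => (N : ℝ) * (lam (y - unitVec (fine N M) μ) - lam y))) x))) ^ 2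
        ≤ Hh ^ 2 * ((N : ℝ) * (((fineOp N M (aK a L K) (((N : ℕ) : ℝ) ^ 2) msq)⁻¹
                *ᵥ (fun y => (N : ℝ) * (lam (y - unitVec (fine N M) μ) - lam y))) (x + unitVec (fine N M) μ')
            - ((fineOp N M (aK a L K) (((N : ℕ) : ℝ) ^ 2) msq)⁻¹
                *ᵥ (fun y => (N : ℝ) * (lam (y - unitVec (fine N M) μ) - lam y))) x)) ^ 2 := by
      intro x
      rw [mul_pow]
      refine mul_le_mul_of_nonneg_right ?_ (sq_nonneg _)
      have habs := abs_le.mp (hh x)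
      exact sq_le_sq' (by linarith) habs.2
    have hCE : 1 ≤ (C₀ + 1) * Real.exp (2 * δ₀) * E := by
      have h1 : (1 : ℝ) ≤ Real.exp (2 * δ₀) * E := by
        rw [hEdef, ← Real.exp_add]
        exact Real.one_le_exp (by nlinarith)
      have h2 : Real.exp (2 * δ₀) * E ≤ (C₀ + 1) * (Real.exp (2 * δ₀) * E) :=
        le_mul_of_one_le_left (by positivity) (by linarith)
      linarith
    calc ∑ x, (h x * ((N : ℝ) * (((fineOp N M (aK a L K) (((N : ℕ) : ℝ) ^ 2) msq)⁻¹
                *ᵥ (fun y => (N : ℝ) * (lam (y - unitVec (fine N M) μ) - lam y))) (x + unitVec (fine N M) μ')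
            - ((fineOp N M (aK a L K) (((N : ℕ) : ℝ) ^ 2) msq)⁻¹
                *ᵥ (fun y => (N : ℝ) * (lam (y - unitVec (fine N M) μ) - lam y))) x))) ^ 2
        ≤ Hh ^ 2 * ∑ x, ((N : ℝ) * (((fineOp N M (aK a L K) (((N : ℕ) : ℝ) ^ 2) msq)⁻¹
                *ᵥ (fun y => (N : ℝ) * (lam (y - unitVec (fine N M) μ) - lam y))) (x + unitVec (fine N M) μ')
            - ((fineOp N M (aK a L K) (((N : ℕ) : ℝ) ^ 2) msq)⁻¹
                *ᵥ (fun y => (N : ℝ) * (lam (y - unitVec (fine N M) μ) - lam y))) x)) ^ 2 := by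
          rw [Finset.mul_sum]; exact Finset.sum_le_sum fun x _ => hstep x
      _ ≤ Hh ^ 2 * ∑ z, lam z ^ 2 := mul_le_mul_of_nonneg_left hFsum (sq_nonneg _)
      _ = (1 * Hh) ^ 2 * ∑ z, lam z ^ 2 := by rw [one_mul]
      _ ≤ ((C₀ + 1) * Real.exp (2 * δ₀) * E * Hh) ^ 2 * ∑ z, lam z ^ 2 :=
          mul_le_mul_of_nonneg_right (pow_le_pow_left₀ (by positivity) (mul_le_mul_of_nonneg_right hCE hHh) 2) hlam2
      _ = ((C₀ + 1) * Real.exp (2 * δ₀) * Hh * Real.exp (-(δ₀ * D))) ^ 2 * ∑ z, lam z ^ 2 := by rw [hEdef]; ring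

/-! ## §3 The four localised `L²` entries of (3.46) at `U ≡ 1`, one `(C, δ)` -/

/-- ★★ **[B9] (3.46) AT `U ≡ 1` — THE LOCALISED `L²` ENTRIES `hGλ`, `h∇Gλ`, `hG∇*λ`, `h∇G∇*λ` FOR KING'S FULL `A = 0` PROPAGATOR, ONE `(C, δ)`.**
For odd `L ≥ 3`, `a > 0`, `m₀² ≥ 0` there are `C, δ > 0` such that for every `K ≥ 1` (`N = L^K`), cube `2L^e`, mass `0 < m² ≤ m₀²`, every cut-off `h`
(`|h| ≤ H_h`, `supp h ⊂ b`) and source `λ` (`supp λ ⊂ b′`), with `A₀ = fineOp N M a_K N² m²`, `(∇*_νg)(y) = N(g(y − e_ν) − g(y))`: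
`‖hA₀⁻¹λ‖, ‖hN∇_μA₀⁻¹λ‖, ‖hA₀⁻¹∇*_νλ‖, ‖hN∇_{μ′}A₀⁻¹∇*_μλ‖ ≤ C·H_h·e^{−δ|b−b′|}·‖λ‖` (squared forms) — the printed
«`≤ B₀[(L^jη)², L^jη, L^jη, 1]|h|e^{−δ₀d(y,y′)}‖λ‖`» at `U ≡ 1`, unit-scale sites (parts Ξ-a + §2).  Entries 5–6 of (3.46) are not claimed.
[cite: Balaban1985BackgroundPropagators, Thm 3.1 (3.46) p.398; King1986, (2.13) p.653, Thm 3.3 (3.7) p.656, Prop. 3.7 (3.63) p.663; Balaban1983RegularityDecay, Theorem (1.10) p.573] -/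
theorem kingFullProp_B9Thm31_l2_local_at_trivialU (hLodd : Odd L) (hL : 2 ≤ L) {a : ℝ} (ha : 0 < a) {m0sq : ℝ} (hm0 : 0 ≤ m0sq) :
    ∃ C δ : ℝ, 0 < C ∧ 0 < δ ∧ ∀ (K : ℕ), 1 ≤ K → ∀ (N : ℕ) [NeZero N], N = L ^ K →
      ∀ (e : ℕ) (M : Fin (d + 1) → ℕ) [∀ μ, NeZero (M μ)], (∀ μ, M μ = 2 * L ^ e) →
      ∀ (msq : ℝ), 0 < msq → msq ≤ m0sq → ∀ (lam h : Tor (fine N M) → ℝ) (Hh : ℝ) (b b' : Tor M), 0 ≤ Hh →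
        (∀ x, |h x| ≤ Hh) → (∀ x, h x ≠ 0 → blockOf N M x = b) → (∀ z, lam z ≠ 0 → blockOf N M z = b') →
        (∑ x, (h x * ((fineOp N M (aK a L K) (((N : ℕ) : ℝ) ^ 2) msq)⁻¹ *ᵥ lam) x) ^ 2
            ≤ (C * Hh * Real.exp (-(δ * tdistT M b b'))) ^ 2 * ∑ z, lam z ^ 2) ∧
        (∀ μ : Fin (d + 1), ∑ x, (h x * ((N : ℝ) * (((fineOp N M (aK a L K) (((N : ℕ) : ℝ) ^ 2) msq)⁻¹ *ᵥ lam) (x + unitVec (fine N M) μ)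
            - ((fineOp N M (aK a L K) (((N : ℕ) : ℝ) ^ 2) msq)⁻¹ *ᵥ lam) x))) ^ 2
            ≤ (C * Hh * Real.exp (-(δ * tdistT M b b'))) ^ 2 * ∑ z, lam z ^ 2) ∧
        (∀ ν : Fin (d + 1), ∑ x, (h x * ((fineOp N M (aK a L K) (((N : ℕ) : ℝ) ^ 2) msq)⁻¹
            *ᵥ (fun y => (N : ℝ) * (lam (y - unitVec (fine N M) ν) - lam y))) x) ^ 2
            ≤ (C * Hh * Real.exp (-(δ * tdistT M b b'))) ^ 2 * ∑ z, lam z ^ 2) ∧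
        (∀ μ μ' : Fin (d + 1), ∑ x, (h x * ((N : ℝ) * (((fineOp N M (aK a L K) (((N : ℕ) : ℝ) ^ 2) msq)⁻¹
                *ᵥ (fun y => (N : ℝ) * (lam (y - unitVec (fine N M) μ) - lam y))) (x + unitVec (fine N M) μ')
            - ((fineOp N M (aK a L K) (((N : ℕ) : ℝ) ^ 2) msq)⁻¹
                *ᵥ (fun y => (N : ℝ) * (lam (y - unitVec (fine N M) μ) - lam y))) x))) ^ 2
            ≤ (C * Hh * Real.exp (-(δ * tdistT M b b'))) ^ 2 * ∑ z, lam z ^ 2) := by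
  obtain ⟨C₀, δ₀, hC₀, hδ₀, H₀⟩ := fullPropOp_l2_local (d := d) L hLodd hL ha hm0
  obtain ⟨C₁, δ₁, hC₁, hδ₁, H₁⟩ := fullPropDOp_l2_local (d := d) L hLodd hL ha hm0
  obtain ⟨C₂, δ₂, hC₂, hδ₂, H₂⟩ := fullPropAdjOp_l2_local (d := d) L hLodd hL ha hm0
  obtain ⟨C₃, δ₃, hC₃, hδ₃, H₃⟩ := fullPropMixedOp_l2_local (d := d) L hLodd hL ha hm0
  set C : ℝ := max (max C₀ C₁) (max C₂ C₃) with hCdef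
  set δ : ℝ := min (min δ₀ δ₁) (min δ₂ δ₃) with hδdef
  have hc0 : C₀ ≤ C := (le_max_left _ _).trans (le_max_left _ _)
  have hc1 : C₁ ≤ C := (le_max_right _ _).trans (le_max_left _ _)
  have hc2 : C₂ ≤ C := (le_max_left _ _).trans (le_max_right _ _)
  have hc3 : C₃ ≤ C := (le_max_right _ _).trans (le_max_right _ _)
  have hd0 : δ ≤ δ₀ := (min_le_left _ _).trans (min_le_left _ _)
  have hd1 : δ ≤ δ₁ := (min_le_left _ _).trans (min_le_right _ _)
  have hd2 : δ ≤ δ₂ := (min_le_right _ _).trans (min_le_left _ _)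
  have hd3 : δ ≤ δ₃ := (min_le_right _ _).trans (min_le_right _ _)
  have hδ : 0 < δ := lt_min (lt_min hδ₀ hδ₁) (lt_min hδ₂ hδ₃)
  have hC : 0 < C := lt_of_lt_of_le hC₀ hc0
  refine ⟨C, δ, hC, hδ, ?_⟩
  intro K hK N _ hN e M _ hM msq hmsq hcap lam h Hh b b' hHh hh hsh hsl
  have hD : 0 ≤ tdistT M b b' := tdistT_nonneg M b b'
  have hS : 0 ≤ ∑ z, lam z ^ 2 := Finset.sum_nonneg fun z _ => sq_nonneg _
  -- monotonicity of the squared bound in `(C, δ)`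
  have hmono : ∀ {Ci δi : ℝ}, 0 ≤ Ci → Ci ≤ C → δ ≤ δi →
      (Ci * Hh * Real.exp (-(δi * tdistT M b b'))) ^ 2 * ∑ z, lam z ^ 2 ≤ (C * Hh * Real.exp (-(δ * tdistT M b b'))) ^ 2 * ∑ z, lam z ^ 2 := by
    intro Ci δi hCi0 hCi hδi
    refine mul_le_mul_of_nonneg_right (pow_le_pow_left₀ (by positivity) ?_ 2) hS
    exact mul_le_mul (mul_le_mul_of_nonneg_right hCi hHh)
      (Real.exp_le_exp.mpr (neg_le_neg (mul_le_mul_of_nonneg_right hδi hD))) (Real.exp_pos _).le (by positivity)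
  refine ⟨?_, fun μ => ?_, fun ν => ?_, fun μ μ' => ?_⟩
  · exact (H₀ K hK N hN e M hM msq hmsq hcap lam h Hh b b' hHh hh hsh hsl).trans (hmono hC₀.le hc0 hd0)
  · exact (H₁ K hK N hN e M hM msq hmsq hcap μ lam h Hh b b' hHh hh hsh hsl).trans (hmono hC₁.le hc1 hd1)
  · exact (H₂ K hK N hN e M hM msq hmsq hcap ν lam h Hh b b' hHh hh hsh hsl).trans (hmono hC₂.le hc2 hd2)
  · exact (H₃ K hK N hN e M hM msq hmsq hcap μ μ' lam h Hh b b' hHh hh hsh hsl).trans (hmono hC₃.le hc3 hd3)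

end Summit.QuantumFields.YangMills.BalabanUVNodes.N15KingModelRung.Curved
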